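import Summits.PneNP.PneNP.Theses.OneSlice
import Literature.Computability.Complexity.RossmanMonotoneClique

/-!
# Sketch — crux-ideate stmt-PneNP-2832 (`SliceTarget`), ideator 2, round 1

First lemmas of the idea card `hosted-sprinkle-one-slice` (host hard-wiring INSIDE one slice:
`SliceTarget ⟸ HostedSliceIndist`), typed over the in-tree vocabulary of
`Literature.Computability.Complexity` (`edgeCount`, `plantClique`, `cliqueCount`, `Circuit`,
`monotoneBasis`) and the route decl `Summit.PneNP.PneNP.Theses.OneSlice.SliceTarget`.
Nothing is proved here; every `def … : Prop` is a statement the line would prove or reduce to.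
-/

noncomputable section

namespace Summit.PneNP.PneNP.Cruxes.SliceTarget.Ideator2

open Finset Filter Classical Literature.Computability.Complexity

/-- Potential edges of `K_n`. -/
abbrev E (n : ℕ) : Type := ((⊤ : SimpleGraph (Fin n)).edgeSet)

/-- The critical edge density `p_k(n) = n^{-2/(k-1)}`. -/
def pcrit (n k : ℕ) : ℝ := (n : ℝ) ^ (-(2 : ℝ) / ((k : ℝ) - 1))

/-- The critical edge count `m_k(n) = ⌊C(n,2) · n^{-2/(k-1)}⌋` (as in `SliceTarget`). -/
def mcrit (n k : ℕ) : ℕ := ⌊((n.choose 2 : ℕ) : ℝ) * pcrit n k⌋₊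

/-- `i` is a central edge count: `|i - m_k(n)| ≤ m_k(n)^{3/4}` (the window of `SliceTarget`). -/
def IsCentral (n k i : ℕ) : Prop := |(i : ℝ) - (mcrit n k : ℝ)| ≤ (mcrit n k : ℝ) ^ ((3 : ℝ) / 4)

/-- The subcritical sprinkle size `s = C(n,2) · n^{-2(1+ε)/(k-1)}` (real-valued centre). -/
def sprinkleCentre (n k : ℕ) (ε : ℝ) : ℝ :=
  ((n.choose 2 : ℕ) : ℝ) * (n : ℝ) ^ (-(2 : ℝ) * (1 + ε) / ((k : ℝ) - 1))

/-- `s` is a typical sprinkle size: within `centre^{3/4}` of the centre. -/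
def IsSprinkleSize (n k : ℕ) (ε : ℝ) (s : ℕ) : Prop :=
  |(s : ℝ) - sprinkleCentre n k ε| ≤ (sprinkleCentre n k ε) ^ ((3 : ℝ) / 4)

/-- The Hamming slice `{x : e(x) = i}` of the edge cube. -/
def slice (n i : ℕ) : Finset (E n → Bool) := univ.filter fun x => edgeCount x = i

/-- Sprinkles relative to a host `H`: graphs `S` with exactly `t` edges, none of them in `H`
(uniform `t`-subsets of the free pairs `E(K_n) ∖ H`). -/
def sprinkles (n t : ℕ) (H : E n → Bool) : Finset (E n → Bool) :=
  univ.filter fun S => edgeCount S = t ∧ ∀ e, H e = true → S e = false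

/-- Indicator as a real number. -/
def ind (b : Bool) : ℝ := if b = true then 1 else 0

/-- **Hosted acceptance of the null test**: `Pr_S[C(H ∪ S) = 1]`, `S` a uniform `t`-sprinkle
outside `H` (junk `0` if there is none). -/
def nullAccept {n : ℕ} (C : Circuit (E n)) (H : E n → Bool) (t : ℕ) : ℝ :=
  (∑ S ∈ sprinkles n t H, ind (C.eval (H ⊔ S))) / ((sprinkles n t H).card : ℝ)

/-- **Hosted acceptance of the RECENTRED planted test**: `Pr_{S',A}[C(H ∪ S' ∪ K_A) = 1]`,
`S'` a uniform `(t - C(k,2))`-sprinkle outside `H`, `A` a uniform `k`-set — so that the planted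
input has the SAME weight `e(H) + t` as the null input whenever `K_A` avoids `H ∪ S'`. -/
def plantedAccept {n : ℕ} (k : ℕ) (C : Circuit (E n)) (H : E n → Bool) (t : ℕ) : ℝ :=
  (∑ A ∈ powersetCard k (univ : Finset (Fin n)), ∑ S ∈ sprinkles n (t - k.choose 2) H,
      ind (C.eval (plantClique A (H ⊔ S)))) /
    (((n.choose k : ℕ) : ℝ) * ((sprinkles n (t - k.choose 2) H).card : ℝ))

/-- Clique-free hosts: the graphs of slice `h` without a `k`-clique. -/
def cfHosts (n k h : ℕ) : Finset (E n → Bool) := (slice n h).filter fun H => cliqueCount n k H = 0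

/-- **C⁺ of the card — `HostedSliceIndist`.** For every exponent `c` there are `k ≥ 5` and a
sprinkle exponent `ε > 0` such that for every advantage `γ > 0`, eventually in `n`: for every
central slice `i`, every typical sprinkle size `s` and every monotone `{∧₂,∨₂}`-circuit `C` with at
most `n^c` gates, ON AVERAGE over the clique-free hosts `H` of slice `i - s`, the hard-wired circuit
`y ↦ C(H ∪ y)` cannot tell a RECENTRED planted `k`-clique in a uniform `s`-sprinkle of the free
pairs from a uniform `s`-sprinkle: `E_H[ Pr[C(H ∪ S' ∪ K_A)=1] - Pr[C(H ∪ S)=1] ] ≤ γ`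
(`|S'| = s - C(k,2)`, `|S| = s`). Both test inputs live on the ONE slice `i` where `C` is
constrained; the negative law `H ∪ S` is uniform on slice `i` and circuit-independent. -/
def HostedSliceIndist : Prop :=
  ∀ c : ℕ, ∃ k : ℕ, 5 ≤ k ∧ ∃ ε : ℝ, 0 < ε ∧ ∀ γ : ℝ, 0 < γ → ∀ᶠ n : ℕ in atTop,
    ∀ i : ℕ, IsCentral n k i → ∀ s : ℕ, IsSprinkleSize n k ε s →
      ∀ C : Circuit (E n), C.IsOver monotoneBasis → C.size ≤ n ^ c →
        (∑ H ∈ cfHosts n k (i - s), (plantedAccept k C H s - nullAccept C H s)) /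
            ((cfHosts n k (i - s)).card : ℝ) ≤ γ

/-- The law of the central slice conditioned on EXACTLY ONE `k`-clique, as a function on graphs. -/
def condOneCliqueSlice (n k i : ℕ) (x : E n → Bool) : ℝ :=
  ind (decide (edgeCount x = i ∧ cliqueCount n k x = 1)) /
    (((slice n i).filter fun y => cliqueCount n k y = 1).card : ℝ)

/-- The slice-planted law: `G' ∪ K_A` with `G'` uniform on slice `i - C(k,2)` conditioned
clique-free and `A` a uniform `k`-set, as a function on graphs. -/
def plantedCliqueFreeSlice (n k i : ℕ) (x : E n → Bool) : ℝ :=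
  (∑ A ∈ powersetCard k (univ : Finset (Fin n)),
      (((slice n (i - k.choose 2)).filter fun y => cliqueCount n k y = 0 ∧ plantClique A y = x).card : ℝ)) /
    (((n.choose k : ℕ) : ℝ) * (((slice n (i - k.choose 2)).filter fun y => cliqueCount n k y = 0).card : ℝ))

/-- **First lemma — `SliceLemma23` (de-Poissonised Rossman Lemma 23).** At the critical scaling,
uniformly over central slices `i`, the law of the slice-`i` graph conditioned on having exactly one
`k`-clique and the law of (clique-free slice-`(i - C(k,2))` graph) `∪ K_A` are `o(1)`-close in
total variation. In tree for `G(n,p)`: `Rossman2010_plantedVsConditioned_holds` (PROVED); the slice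
version is the same second-moment computation with hypergeometric in place of binomial weights. -/
def SliceLemma23 : Prop :=
  ∀ k : ℕ, 5 ≤ k → ∀ η : ℝ, 0 < η → ∀ᶠ n : ℕ in atTop, ∀ i : ℕ, IsCentral n k i →
    (∑ x : E n → Bool, |condOneCliqueSlice n k i x - plantedCliqueFreeSlice n k i x|) ≤ η

/-- **Second lemma — `SprinkleRarity`.** A typical sprinkle of `s ≍ m·p^ε` fresh edges into a
clique-free graph of a central slice almost never creates a `k`-clique (first moment:
`λ · ((1 + s/m)^{C(k,2)} - 1) → 0`), on average over the host. -/
def SprinkleRarity : Prop :=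
  ∀ k : ℕ, 5 ≤ k → ∀ ε : ℝ, 0 < ε → ∀ η : ℝ, 0 < η → ∀ᶠ n : ℕ in atTop,
    ∀ i : ℕ, IsCentral n k i → ∀ s : ℕ, IsSprinkleSize n k ε s →
      (∑ H ∈ (slice n (i - s)).filter (fun H => cliqueCount n k H = 0),
          (∑ S ∈ sprinkles n s H, ind (decide (cliqueCount n k (H ⊔ S) ≠ 0))) /
            ((sprinkles n s H).card : ℝ)) /
        (((slice n (i - s)).filter fun H => cliqueCount n k H = 0).card : ℝ) ≤ η

/-- **The transfer (composition target of a crux-plan).** Host hard-wiring inside one slice: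
`SliceLemma23 → SprinkleRarity → HostedSliceIndist → SliceTarget`. Proof sketch (bookkeeping,
~Rossman2010_twoThresholds_of_thm1_lemma23 with the host on slice `j - s`): a `δ`-accurate monotone
`C` on a central slice `j` (with `δ = δ(k)` tiny) gives, for a `3/4`-fraction of the clique-free
hosts `H` on slice `j - s`, `nullAccept C H s ≤ 4δe^{1/k!} + o(1)` (accuracy on the clique-free part
+ `SprinkleRarity`) and `plantedAccept k C H s ≥ 1 - 16δ·k! - o(1)` (accuracy on the one-clique
part + `SliceLemma23`), i.e. advantage `≥ 1/2 > γ`. -/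
def Transfer : Prop :=
  SliceLemma23 → SprinkleRarity → HostedSliceIndist →
    Summit.PneNP.PneNP.Theses.OneSlice.SliceTarget


/-! ## Card B — `certify-not-decide`: transfer UP to co-nondeterministic (certificate) hardness -/

/-- `F_V(x)`: the nondeterministic acceptance of a verifier circuit `V` on inputs
`(edges ⊕ witness bits)` — "some witness `w ∈ {0,1}^W` makes `V(x,w)` accept". -/
def ndAccepts {n W : ℕ} (V : Circuit (E n ⊕ Fin W)) (x : E n → Bool) : Prop :=
  ∃ w : Fin W → Bool, V.eval (Sum.elim x w) = true

/-- **C⁺ of card B — `SliceCertLB`** (average-case co-nondeterministic lower bound on the slice):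
for every `c` there are `k ≥ 3`, `δ > 0` such that eventually, on every central slice `j`, every
fan-in-2 verifier `V` with `≤ n^c` gates and `n^c` witness bits mis-certifies clique-FREENESS
(`F_V(x) ≠ [ω_k(x) = 0]`) on more than a `δ`-fraction of the slice. Sound refutation systems with
short proofs (tree-like / regular resolution, CP, Frege, EF with `n^c`-size proofs of the
`k`-clique CNF of `x`) are special cases of such `V`. -/
def SliceCertLB : Prop :=
  ∀ c : ℕ, ∃ k : ℕ, 3 ≤ k ∧ ∃ δ : ℝ, 0 < δ ∧ ∀ᶠ n : ℕ in atTop, ∀ j : ℕ, IsCentral n k j →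
    ∀ V : Circuit (E n ⊕ Fin (n ^ c)), V.IsOver B2 → V.size ≤ n ^ c →
      δ * ((slice n j).card : ℝ) <
        (((slice n j).filter fun x =>
            decide (ndAccepts V x) ≠ decide (cliqueCount n k x = 0)).card : ℝ)

/-- The transfer of card B is one line of logic plus input re-indexing: a `δ`-accurate monotone
decider `C` on slice `j` gives the verifier `V(x,w) := ¬C(x)` (one extra gate, `B2 ⊇ {∧₂,∨₂,¬}`),
with the same error set. -/
def TransferB : Prop := SliceCertLB → Summit.PneNP.PneNP.Theses.OneSlice.SliceTarget

/-! ### Bottom rung of card B's ladder: DPLL / tree-like resolution on the `k`-clique CNF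
(block encoding `x_{i,v}` = "`v` is the `i`-th clique vertex"), for the clique-free graphs of a
central critical slice — Beyersdorff–Galesi–Lauria 2013 / ABdRLNR (JACM 2021, Thm 5.1 at `ξ → 1`)
de-Poissonised and conditioned. -/

/-- Clauses of the block-encoded `k`-clique CNF of a graph `x` on `Fin n`:
`block i` = `⋁_v x_{i,v}`; `conflict i u j v` = `¬x_{i,u} ∨ ¬x_{j,v}`, present when `i ≠ j` and
`u, v` are equal or non-adjacent in `x`. -/
inductive CliqueClause (k n : ℕ) : Type
  | block : Fin k → CliqueClause k n
  | conflict : Fin k → Fin n → Fin k → Fin n → CliqueClause k n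

/-- The clause is a clause OF the formula `Clique_k(x)`. -/
def CliqueClause.InFormula {k n : ℕ} (x : E n → Bool) : CliqueClause k n → Prop
  | .block _ => True
  | .conflict i u j v => i ≠ j ∧ (u = v ∨ ∀ h : s(u, v) ∈ (⊤ : SimpleGraph (Fin n)).edgeSet, x ⟨s(u, v), h⟩ = false)

/-- The clause is falsified by the total assignment `a : Fin k × Fin n → Bool`. -/
def CliqueClause.FalsifiedBy {k n : ℕ} (a : Fin k × Fin n → Bool) : CliqueClause k n → Prop
  | .block i => ∀ v, a (i, v) = false
  | .conflict i u j v => a (i, u) = true ∧ a (j, v) = true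

/-- DPLL decision trees over the variables `x_{i,v}`, leaves labelled by clauses. -/
inductive DecTree (k n : ℕ) : Type
  | leaf : CliqueClause k n → DecTree k n
  | node : Fin k × Fin n → DecTree k n → DecTree k n → DecTree k n

/-- Number of leaves (= tree-like resolution size). -/
def DecTree.leaves {k n : ℕ} : DecTree k n → ℕ
  | .leaf _ => 1
  | .node _ t₀ t₁ => t₀.leaves + t₁.leaves

/-- The clause at the leaf reached by the total assignment `a`. -/
def DecTree.reach {k n : ℕ} (a : Fin k × Fin n → Bool) : DecTree k n → CliqueClause k n
  | .leaf C => C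
  | .node y t₀ t₁ => if a y = true then t₁.reach a else t₀.reach a

/-- `T` solves the falsified-clause search problem of `Clique_k(x)`: every total assignment is
led to a clause of the formula that it falsifies (so `Clique_k(x)` is unsatisfiable, i.e. `x` is
`k`-clique-free, and `T` is a tree-like resolution refutation). -/
def DecTree.Solves {k n : ℕ} (T : DecTree k n) (x : E n → Bool) : Prop :=
  ∀ a : Fin k × Fin n → Bool, (T.reach a).InFormula x ∧ (T.reach a).FalsifiedBy a

/-- **First rung — `TreeLikeSliceRung`.** There is `α > 0` such that for all large `k`,
eventually in `n`, on every central slice `j`, all but an `η`-fraction of the slice consists of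
graphs that are either NOT clique-free or have no DPLL refutation of `Clique_k` with `≤ n^{αk}`
leaves. (BGL13 prove `n^{Ω(k)}` for tree-like resolution on `G(n,p)`; ABdRLNR Thm 5.1 gives
`n^{Ω(k/ξ²)}` even for REGULAR resolution at density `n^{-2ξ/(k-1)}`, `ξ > 1`; the rung is the
`ξ = 1`, fixed-edge-count, conditioned-clique-free version.) -/
def TreeLikeSliceRung : Prop :=
  ∃ α : ℝ, 0 < α ∧ ∃ k₀ : ℕ, ∀ k : ℕ, k₀ ≤ k → ∀ η : ℝ, 0 < η → ∀ᶠ n : ℕ in atTop,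
    ∀ j : ℕ, IsCentral n k j →
      (((slice n j).filter fun x => cliqueCount n k x = 0 ∧
          ∃ T : DecTree k n, T.Solves x ∧ (T.leaves : ℝ) ≤ (n : ℝ) ^ (α * k)).card : ℝ)
        ≤ η * ((slice n j).card : ℝ)

/-- Sanity: the three statements and the route decl elaborate together. -/
example : Prop := Transfer ∧ TransferB ∧ TreeLikeSliceRung

end Summit.PneNP.PneNP.Cruxes.SliceTarget.Ideator2
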